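import Mathlib.Analysis.Calculus.BumpFunction.InnerProduct
import Literature.Analysis.FluidPDE.PressurePoisson
import Literature.Analysis.FluidPDE.StirringCellCalculus
import HarnessLib

/-!
# An explicit stirring cell: a compactly supported Euler–Reynolds subsolution with source and
# prescribed power

Analysis/FluidPDE support file (everything proved; no definitions, no named facts). Let `E` be a
finite-dimensional real inner product space with an orthonormal frame `b` indexed by a type `ι`
with at least two elements (coordinates `vᵢ = ⟪bᵢ, v⟫`, `(∇w)ᵢⱼ = ∂ⱼwᵢ = ⟪bᵢ, Dw bⱼ⟫`). For every
centre `p ∈ E`, radius `ρ > 0` and power `D > 0` there are smooth fields `W, f : E → E` and a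
smooth symmetric matrix field `S : E → (ι × ι → ℝ)`, all supported in the ball `B(p, ρ)`, with
`div W = 0`, `div f = 0`, such that for every ambient pressure level `c` above a threshold the
Reynolds stress `R = c·Id + S` is positive definite everywhere, the stationary Euler–Reynolds
system with source `div (W ⊗ W + R) = f` holds in the weak form
`∫ (⟪W, Dw·W⟫ + Σᵢⱼ Sᵢⱼ ∂ⱼwᵢ + ⟪f, w⟫) = 0` for **every** smooth compactly supported `w`
(the `c·Id` part pairs to `c ∫ div w = 0` and is omitted), and the power is exactly
`∫ ⟪f, W⟫ = D` (`exists_stirringCell`). In the language of De Lellis–Székelyhidi (Arch. Ration.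
Mech. Anal. 195 (2010), §2) `(W, R)` is a smooth compactly supported strict *subsolution* driven by
the smooth divergence-free force `f`; it is the "stirring cell" planted next to a sink in the
torus scaffold of the point-sink construction (`Summits/AnomalousDissipation`).

**Construction** (elementary; pointwise identities in `StirringCellCalculus.lean`). Take the planar
divergence-free field `W = ∂₁ψ b₀ − ∂₀ψ b₁` of a bump `ψ` centred at `p`, the symmetric gradient
`Tᵢⱼ = κ (∂ᵢWⱼ + ∂ⱼWᵢ)`, `Sᵢⱼ = Tᵢⱼ − WᵢWⱼ` and `f = κ ΔW`. Then `Σⱼ ∂ⱼ(WᵢWⱼ + c δᵢⱼ + Sᵢⱼ) =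
Σⱼ ∂ⱼTᵢⱼ = κ (∂ᵢ div W + ΔWᵢ) = fᵢ` identically (pressure `0`), `div f = κ Δ div W = 0`, and the
power is `∫ ⟪f, W⟫ = κ ∫ ⟪ΔW, W⟫ = −κ Σⱼ ∫ |∂ⱼW|²`; since `W ≢ 0` is compactly supported,
`N = Σⱼ ∫ |∂ⱼW|² > 0` and `κ = −D/N` gives power `D`. Positivity of `c·Id + S` for
`c > |ι| sup |Sᵢⱼ|` is diagonal dominance.

## Contents

* `integral_stirring_eq_zero` — the weak identity (integrate the cell integrand identity
  `stirring_integrand_eq`; no boundary terms, `Fluid.integral_fderiv_apply_eq_zero`);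
* `integral_inner_smul_laplacian_self` — `∫ ⟪κΔW, W⟫ = −κ Σⱼ ∫ |∂ⱼW|²` (Green, tree
  `integral_inner_laplacian_add_eq_zero`);
* `sum_integral_norm_fderiv_sq_pos` — `Σⱼ ∫ |∂ⱼW|² > 0` for a compactly supported `C¹` field that
  is not identically zero;
* `posDef_diagonal_add_of_abs_le` — `c·Id + S ≻ 0` when `|Sᵢⱼ| ≤ M`, `S` symmetric, `|ι| M < c`;
* `exists_stirringCell` — the cell.

## Mathlib / tree search

`lean search 'stirring|StirringCell|subsolution'`: nothing of this kind in the tree (torus-side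
antidivergence operators `Torus.antidivergence`, Bogovskiĭ-type weak inverses
`MaoOhTao.hasWeakSymmDivInverse_annulus` exist but are not needed: the cell is explicit). Reused:
`divergence_laplacian_eq_zero` (`PressurePoisson`), `integral_inner_laplacian_add_eq_zero`,
`integral_fderiv_apply_eq_zero` (`WholeSpaceIBP`), Mathlib `ContDiffBump`,
`Matrix.PosDef.of_dotProduct_mulVec_pos`, `sq_sum_le_card_mul_sum_sq`,
`Continuous.integral_pos_of_hasCompactSupport_nonneg_nonzero`, `is_const_of_fderiv_eq_zero`.

## References

* C. De Lellis, L. Székelyhidi Jr., *On admissibility criteria for weak solutions of the Euler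
  equations*, Arch. Ration. Mech. Anal. 195 (2010), §2 (subsolutions, Reynolds stress).
* A. J. Majda, A. L. Bertozzi, *Vorticity and Incompressible Flow* (CUP 2002), §1.1.
-/

noncomputable section

open MeasureTheory Set Function Filter Metric
open scoped RealInnerProductSpace Laplacian ContDiff Topology

namespace Literature.Analysis.FluidPDE

variable {E : Type*} [NormedAddCommGroup E] [InnerProductSpace ℝ E] [FiniteDimensional ℝ E]
  [MeasurableSpace E] [BorelSpace E]
variable {ι : Type*} [Fintype ι]

/-! ### Integral identities of the cell -/

section Integrals

variable {W : E → E}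

omit [FiniteDimensional ℝ E] [MeasurableSpace E] [BorelSpace E] in
/-- Coordinates of the velocity gradient of a smooth field are smooth functions. [folklore] -/
theorem contDiff_inner_fderiv_apply (hW : ContDiff ℝ ∞ W) (u v : E) :
    ContDiff ℝ ∞ fun y => ⟪u, fderiv ℝ W y v⟫ :=
  (innerSL ℝ u).contDiff.comp ((hW.fderiv_right le_rfl).clm_apply contDiff_const)

/-- **The weak Euler–Reynolds identity of the cell.** For a smooth compactly supported
divergence-free `W`, `κ ∈ ℝ`, `Sᵢⱼ = κ(∂ᵢWⱼ + ∂ⱼWᵢ) − WᵢWⱼ`, `f = κΔW` and every smooth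
compactly supported test field `w` (divergence free or not):
`∫ (⟪W, Dw·W⟫ + Σᵢⱼ Sᵢⱼ ⟪bᵢ, Dw bⱼ⟫ + ⟪f, w⟫) = 0` — the integrand is `Σᵢⱼ ∂ⱼ(Tᵢⱼ wᵢ)`
(`stirring_integrand_eq`) and `∫ ∂ⱼ(Tᵢⱼ wᵢ) = 0` (no boundary terms). [folklore] -/
theorem integral_stirring_eq_zero (b : OrthonormalBasis ι ℝ E) (hW : ContDiff ℝ ∞ W)
    (hdiv : VectorCalculus.IsDivFree W) (κ : ℝ) {w : E → E} (hw : ContDiff ℝ ∞ w)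
    (hwc : HasCompactSupport w) :
    ∫ x, (⟪W x, fderiv ℝ w x (W x)⟫ +
        ∑ i, ∑ j, (κ * (⟪b j, fderiv ℝ W x (b i)⟫ + ⟪b i, fderiv ℝ W x (b j)⟫) -
          ⟪b i, W x⟫ * ⟪b j, W x⟫) * ⟪b i, fderiv ℝ w x (b j)⟫ + ⟪κ • (Δ W) x, w x⟫) = 0 := by
  have hW2 : ContDiff ℝ 2 W := hW.of_le (by norm_cast)
  have hwd : Differentiable ℝ w := hw.differentiable (by simp)
  simp_rw [fun x => stirring_integrand_eq b hW2 hdiv κ (hwd x)]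
  -- the products `Tᵢⱼ wᵢ` are `C¹` with compact support
  set h : ι → ι → E → ℝ := fun i j y =>
    κ * (⟪b j, fderiv ℝ W y (b i)⟫ + ⟪b i, fderiv ℝ W y (b j)⟫) * ⟪b i, w y⟫ with hh
  have hhs : ∀ i j, ContDiff ℝ 1 (h i j) := fun i j =>
    ((contDiff_const.mul ((contDiff_inner_fderiv_apply hW (b j) (b i)).add
      (contDiff_inner_fderiv_apply hW (b i) (b j)))).mul
      ((innerSL ℝ (b i)).contDiff.comp hw)).of_le (by norm_cast)
  have hhc : ∀ i j, HasCompactSupport (h i j) := fun i j =>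
    (hwc.comp_left (g := innerSL ℝ (b i)) (map_zero _)).mul_left
  have hint : ∀ i j, Integrable (fun x => fderiv ℝ (h i j) x (b j)) (volume : Measure E) :=
    fun i j => (((hhs i j).continuous_fderiv one_ne_zero).clm_apply continuous_const)
      |>.integrable_of_hasCompactSupport ((hhc i j).fderiv_apply (𝕜 := ℝ) (b j))
  change ∫ x, ∑ i, ∑ j, fderiv ℝ (h i j) x (b j) = 0
  rw [integral_finsetSum _ fun i _ => integrable_finsetSum _ fun j _ => hint i j]
  refine Finset.sum_eq_zero fun i _ => ?_
  rw [integral_finsetSum _ fun j _ => hint i j]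
  exact Finset.sum_eq_zero fun j _ => integral_fderiv_apply_eq_zero (hhs i j) (hhc i j) (b j)

/-- **Power of the cell**: `∫ ⟪κ ΔW, W⟫ = −κ Σⱼ ∫ |∂ⱼ W|²` for a smooth compactly supported `W`
(Green's first identity without boundary, `integral_inner_laplacian_add_eq_zero`). [folklore] -/
theorem integral_inner_smul_laplacian_self (b : OrthonormalBasis ι ℝ E) (hW : ContDiff ℝ ∞ W)
    (hc : HasCompactSupport W) (κ : ℝ) :
    ∫ x, ⟪κ • (Δ W) x, W x⟫ = -κ * ∑ j, ∫ x, ‖fderiv ℝ W x (b j)‖ ^ 2 := by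
  have h := integral_inner_laplacian_add_eq_zero b (v := W) (w := W) (hW.of_le (by norm_cast))
    (hW.of_le (by norm_cast)) (Or.inl hc)
  simp_rw [real_inner_self_eq_norm_sq] at h
  simp_rw [real_inner_smul_left, integral_const_mul]
  rw [eq_neg_of_add_eq_zero_left h]
  ring

/-- **A non-trivial compactly supported field has positive gradient energy**: if
`W ∈ C¹_c(E; E)` does not vanish identically then `Σⱼ ∫ |∂ⱼW|² > 0` (otherwise every `∂ⱼW`
vanishes identically, being continuous, so `W` is constant and, vanishing off a compact set of
the non-compact space `E`, zero). [folklore] -/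
theorem sum_integral_norm_fderiv_sq_pos [Nontrivial E] (b : OrthonormalBasis ι ℝ E)
    (hW : ContDiff ℝ 1 W) (hc : HasCompactSupport W) (hne : ∃ x, W x ≠ 0) :
    0 < ∑ j, ∫ x, ‖fderiv ℝ W x (b j)‖ ^ 2 := by
  by_contra hle
  push Not at hle
  have hnn : ∀ j, 0 ≤ ∫ x, ‖fderiv ℝ W x (b j)‖ ^ 2 := fun j => integral_nonneg fun _ => sq_nonneg _
  have hzero : ∀ j, ∫ x, ‖fderiv ℝ W x (b j)‖ ^ 2 = 0 := fun j =>
    (Finset.sum_eq_zero_iff_of_nonneg fun j _ => hnn j).1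
      (le_antisymm hle (Finset.sum_nonneg fun j _ => hnn j)) j (Finset.mem_univ j)
  have hcont : Continuous (fderiv ℝ W) := hW.continuous_fderiv one_ne_zero
  -- every partial derivative vanishes identically
  have hD : ∀ j x, fderiv ℝ W x (b j) = 0 := by
    intro j x
    by_contra hx
    have hpos := Continuous.integral_pos_of_hasCompactSupport_nonneg_nonzero (μ := volume)
      (f := fun y => ‖fderiv ℝ W y (b j)‖ ^ 2) (x := x)
      ((hcont.clm_apply continuous_const).norm.pow 2)
      ((hc.fderiv_apply (𝕜 := ℝ) (b j)).comp_left (g := fun v : E => ‖v‖ ^ 2) (by simp))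
      (fun _ => sq_nonneg _) (by simpa using hx)
    exact hpos.ne' (hzero j)
  have hD0 : ∀ x, fderiv ℝ W x = 0 := fun x => by
    refine ContinuousLinearMap.ext fun v => ?_
    rw [← b.sum_repr' v]
    simp [map_sum, hD]
  obtain ⟨x₀, hx₀⟩ := hne
  obtain ⟨y, hy⟩ : ∃ y, W y = 0 := by
    obtain ⟨y, hy⟩ := (Set.ne_univ_iff_exists_notMem _).1
      (hc.isCompact.ne_univ : tsupport W ≠ univ)
    exact ⟨y, image_eq_zero_of_notMem_tsupport hy⟩
  exact hx₀ ((is_const_of_fderiv_eq_zero (hW.differentiable one_ne_zero) hD0 x₀ y).trans hy)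

end Integrals

/-! ### Positivity of the Reynolds stress `c·Id + S` -/

section PosDef

variable [DecidableEq ι]

omit [InnerProductSpace ℝ E] [FiniteDimensional ℝ E] [MeasurableSpace E] [BorelSpace E]
  [DecidableEq ι] in
/-- A continuous compactly supported matrix field has uniformly bounded entries. [folklore] -/
theorem exists_forall_abs_apply_apply_le [NormedSpace ℝ E] {S : E → ι → ι → ℝ}
    (hS : Continuous S) (hc : HasCompactSupport S) : ∃ M : ℝ, 0 ≤ M ∧ ∀ x i j, |S x i j| ≤ M := by
  obtain ⟨C, hC⟩ := hS.bounded_above_of_compact_support hc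
  refine ⟨max C 0, le_max_right _ _, fun x i j => ?_⟩
  calc |S x i j| = ‖S x i j‖ := (Real.norm_eq_abs _).symm
    _ ≤ ‖S x i‖ := norm_le_pi_norm (S x i) j
    _ ≤ ‖S x‖ := norm_le_pi_norm (S x) i
    _ ≤ max C 0 := (hC x).trans (le_max_left _ _)

/-- The quadratic form of `c·Id + S`: `xᵀ (c·Id + S) x = c Σᵢ xᵢ² + Σᵢⱼ Sᵢⱼ xᵢ xⱼ`. [folklore] -/
theorem dotProduct_diagonal_add_mulVec (S : ι → ι → ℝ) (c : ℝ) (x : ι → ℝ) :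
    star x ⬝ᵥ ((Matrix.of fun i j => (if i = j then c else 0) + S i j).mulVec x) =
      c * ∑ i, x i ^ 2 + ∑ i, ∑ j, S i j * (x i * x j) := by
  simp only [dotProduct, Matrix.mulVec, Matrix.of_apply, Pi.star_apply, star_trivial, add_mul,
    ite_mul, zero_mul, Finset.sum_add_distrib, Finset.sum_ite_eq, Finset.mem_univ, if_true, mul_add,
    Finset.mul_sum]
  congr 1
  · exact Finset.sum_congr rfl fun i _ => by ring
  · exact Finset.sum_congr rfl fun i _ => Finset.sum_congr rfl fun j _ => by ring

/-- **Diagonal dominance.** If `|Sᵢⱼ| ≤ M`, `S` is symmetric and `|ι| M < c`, then the real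
symmetric matrix `c·Id + S` is positive definite:
`xᵀ(c·Id + S)x ≥ c|x|² − M (Σ|xᵢ|)² ≥ (c − |ι| M)|x|² > 0` (Cauchy–Schwarz). [folklore] -/
theorem posDef_diagonal_add_of_abs_le {S : ι → ι → ℝ} {M c : ℝ} (hS : ∀ i j, |S i j| ≤ M)
    (hsymm : ∀ i j, S i j = S j i) (hc : Fintype.card ι * M < c) :
    (Matrix.of fun i j => (if i = j then c else 0) + S i j).PosDef := by
  refine Matrix.PosDef.of_dotProduct_mulVec_pos (Matrix.IsHermitian.ext fun i j => ?_)
    fun x hx => ?_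
  · simp only [Matrix.of_apply, star_trivial, hsymm j i]
    by_cases hij : i = j
    · subst hij; rfl
    · rw [if_neg hij, if_neg (Ne.symm hij)]
  · rw [dotProduct_diagonal_add_mulVec]
    obtain ⟨i₀, hi₀⟩ := Function.ne_iff.1 hx
    have hsq : 0 < ∑ i, x i ^ 2 := lt_of_lt_of_le (sq_pos_iff.mpr hi₀)
      (Finset.single_le_sum (f := fun i => x i ^ 2) (fun i _ => sq_nonneg _) (Finset.mem_univ i₀))
    have hquad : -(M * (∑ i, |x i|) ^ 2) ≤ ∑ i, ∑ j, S i j * (x i * x j) := by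
      rw [sq, Finset.sum_mul_sum, Finset.mul_sum, ← Finset.sum_neg_distrib]
      refine Finset.sum_le_sum fun i _ => ?_
      rw [Finset.mul_sum, ← Finset.sum_neg_distrib]
      refine Finset.sum_le_sum fun j _ => ?_
      have h1 : |S i j * (x i * x j)| ≤ M * (|x i| * |x j|) := by
        rw [abs_mul, abs_mul]
        exact mul_le_mul_of_nonneg_right (hS i j) (by positivity)
      linarith [neg_abs_le (S i j * (x i * x j))]
    have hcs : (∑ i, |x i|) ^ 2 ≤ Fintype.card ι * ∑ i, x i ^ 2 := by
      have := sq_sum_le_card_mul_sum_sq (s := (Finset.univ : Finset ι)) (f := fun i => |x i|)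
      simpa [sq_abs] using this
    have hM : 0 ≤ M := (abs_nonneg _).trans (hS i₀ i₀)
    nlinarith

end PosDef

/-! ### The cell -/

/-- **Existence of stirring cells.** Let `b` be an orthonormal frame of `E` with two distinct
indices `i₀ ≠ i₁`. For every centre `p ∈ E`, radius `ρ > 0` and power `D > 0` there are a
threshold `c₀` and smooth fields `W, f : E → E`, `S : E → (ι → ι → ℝ)`, all supported in `B(p, ρ)`,
with `div W = 0` and `div f = 0`, such that: for every `c ≥ c₀`, `c > 0` and `c·Id + S(x)` is
positive definite at every `x`; the stationary Euler–Reynolds system with source,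
`div (W⊗W + c·Id + S) = f`, holds weakly against ALL smooth compactly supported tests
(`∫ ⟪W, Dw·W⟫ + Σᵢⱼ Sᵢⱼ ⟪bᵢ, Dw bⱼ⟫ + ⟪f, w⟫ = 0`; the constant part of the stress pairs to
`c ∫ div w = 0` and is omitted); and the power is `∫ ⟪f, W⟫ = D`. A compactly supported smooth
strict subsolution with smooth divergence-free source in the sense of De Lellis–Székelyhidi (2010),
§2; the construction (`W = ∂₁ψ b₀ − ∂₀ψ b₁`, `S = κ(∇W + ∇Wᵀ) − W⊗W`, `f = κΔW`,
`κ = −D / Σⱼ∫|∂ⱼW|²`) is described in the module docstring. [folklore] -/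
theorem exists_stirringCell [DecidableEq ι] (b : OrthonormalBasis ι ℝ E) {i₀ i₁ : ι}
    (h01 : i₀ ≠ i₁) (p : E) {D ρ : ℝ} (hD : 0 < D) (hρ : 0 < ρ) :
    ∃ (c₀ : ℝ) (W f : E → E) (S : E → ι → ι → ℝ),
      ContDiff ℝ ∞ W ∧ ContDiff ℝ ∞ f ∧ ContDiff ℝ ∞ S ∧
      tsupport W ⊆ ball p ρ ∧ tsupport f ⊆ ball p ρ ∧ tsupport S ⊆ ball p ρ ∧
      (∀ x, VectorCalculus.divergence W x = 0) ∧ (∀ x, VectorCalculus.divergence f x = 0) ∧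
      (∀ c, c₀ ≤ c → 0 < c ∧
        ∀ x, (Matrix.of fun i j => (if i = j then c else 0) + S x i j).PosDef) ∧
      (∀ w : E → E, ContDiff ℝ ∞ w → HasCompactSupport w →
        ∫ x, (⟪W x, fderiv ℝ w x (W x)⟫ +
          ∑ i, ∑ j, S x i j * ⟪b i, fderiv ℝ w x (b j)⟫ + ⟪f x, w x⟫) = 0) ∧
      ∫ x, ⟪f x, W x⟫ = D := by
  haveI : Nontrivial E := ⟨⟨b i₀, 0, b.orthonormal.ne_zero i₀⟩⟩
  -- the bump and the planar field
  let φ : ContDiffBump p := ⟨ρ / 4, ρ / 2, by positivity, by linarith⟩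
  set ψ : E → ℝ := ⇑φ with hψdef
  have hψ : ContDiff ℝ ∞ ψ := φ.contDiff
  have hψsupp : tsupport ψ = closedBall p (ρ / 2) := φ.tsupport_eq
  set W : E → E := fun x => (fderiv ℝ ψ x (b i₁)) • b i₀ - (fderiv ℝ ψ x (b i₀)) • b i₁ with hWdef
  have hW : ContDiff ℝ ∞ W := contDiff_planarField b hψ hWdef
  have hW2 : ContDiff ℝ 2 W := hW.of_le (by norm_cast)
  have hWsupp : tsupport W ⊆ ball p ρ :=
    (tsupport_planarField_subset b hWdef).trans (hψsupp ▸ closedBall_subset_ball (by linarith))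
  have hWc : HasCompactSupport W := HasCompactSupport.of_support_subset_isCompact
    (isCompact_closedBall p ρ) ((subset_tsupport W).trans (hWsupp.trans ball_subset_closedBall))
  have hdiv : VectorCalculus.IsDivFree W :=
    divergence_planarField b (hψ.of_le (by norm_cast)) hWdef
  have hne : ∃ x, W x ≠ 0 := by
    refine exists_planarField_ne_zero b h01 (hψ.of_le (by norm_cast)) hWdef (p := p) (t₀ := ρ) ?_
    have h1 : ψ p = 1 := φ.one_of_mem_closedBall (mem_closedBall_self φ.rIn_pos.le)
    have h0 : ψ (p + ρ • b i₀) = 0 := by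
      apply φ.zero_of_le_dist
      rw [dist_eq_norm, add_sub_cancel_left, norm_smul, b.orthonormal.1 i₀, mul_one,
        Real.norm_of_nonneg hρ.le]
      show ρ / 2 ≤ ρ
      linarith
    rw [h0, h1]
    norm_num
  -- the normalisation
  set N : ℝ := ∑ j, ∫ x, ‖fderiv ℝ W x (b j)‖ ^ 2 with hN
  have hNpos : 0 < N := sum_integral_norm_fderiv_sq_pos b (hW.of_le (by norm_cast)) hWc hne
  set κ : ℝ := -D / N with hκ
  -- the Laplacian of `W` is smooth and supported in `tsupport W`
  have hΔ : ContDiff ℝ ∞ (Δ W) := by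
    rw [show Δ W = fun x => ∑ j, fderiv ℝ (fun y => fderiv ℝ W y (b j)) x (b j) from
      funext (laplacian_eq_sum_fderiv_fderiv b hW2)]
    exact ContDiff.sum fun j _ =>
      (((hW.fderiv_right le_rfl).clm_apply contDiff_const).fderiv_right le_rfl).clm_apply
        contDiff_const
  -- the stress and the force
  set S : E → ι → ι → ℝ := fun x i j =>
    κ * (⟪b j, fderiv ℝ W x (b i)⟫ + ⟪b i, fderiv ℝ W x (b j)⟫) - ⟪b i, W x⟫ * ⟪b j, W x⟫
    with hSdef
  set f : E → E := fun x => κ • (Δ W) x with hfdef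
  have hS : ContDiff ℝ ∞ S := contDiff_pi.2 fun i => contDiff_pi.2 fun j =>
    (contDiff_const.mul ((contDiff_inner_fderiv_apply hW (b j) (b i)).add
      (contDiff_inner_fderiv_apply hW (b i) (b j)))).sub
      (((innerSL ℝ (b i)).contDiff.comp hW).mul ((innerSL ℝ (b j)).contDiff.comp hW))
  have hf : ContDiff ℝ ∞ f := contDiff_const.smul hΔ
  have hS0 : ∀ x, x ∉ tsupport W → S x = 0 := fun x hx => by
    funext i j
    simp [hSdef, fderiv_of_notMem_tsupport ℝ hx, image_eq_zero_of_notMem_tsupport hx]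
  have hf0 : ∀ x, x ∉ tsupport W → f x = 0 := fun x hx => by
    simp [hfdef, laplacian_eq_zero_of_notMem_tsupport hx]
  have hSsupp : tsupport S ⊆ tsupport W :=
    closure_minimal (fun x hx => by_contra fun h => hx (hS0 x h)) (isClosed_tsupport W)
  have hfsupp : tsupport f ⊆ tsupport W :=
    closure_minimal (fun x hx => by_contra fun h => hx (hf0 x h)) (isClosed_tsupport W)
  have hSc : HasCompactSupport S := HasCompactSupport.of_support_subset_isCompact
    (isCompact_closedBall p ρ)
    ((subset_tsupport S).trans (hSsupp.trans (hWsupp.trans ball_subset_closedBall)))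
  -- the ambient level
  obtain ⟨M, hM0, hM⟩ := exists_forall_abs_apply_apply_le hS.continuous hSc
  refine ⟨Fintype.card ι * M + 1, W, f, S, hW, hf, hS, hWsupp, hfsupp.trans hWsupp,
    hSsupp.trans hWsupp, hdiv, fun x => ?_, fun c hc => ⟨?_, fun x => ?_⟩, fun w hw hwc => ?_, ?_⟩
  · -- `div f = κ div ΔW = 0`
    rw [hfdef, divergence_eq_traceCLM, fderiv_fun_const_smul ((hΔ.differentiable (by simp)) x),
      map_smul, ← divergence_eq_traceCLM,
      divergence_laplacian_eq_zero (hW.of_le (by norm_cast)) hdiv x, smul_zero]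
  · -- `0 < c`
    have : (0 : ℝ) ≤ Fintype.card ι * M := by positivity
    linarith
  · -- positivity of `c·Id + S`
    refine posDef_diagonal_add_of_abs_le (hM x) (fun i j => ?_) (by linarith)
    simp only [hSdef]
    ring
  · -- the weak identity
    exact integral_stirring_eq_zero b hW hdiv κ hw hwc
  · -- the power
    rw [hfdef, integral_inner_smul_laplacian_self b hW hWc κ, ← hN, hκ]
    field_simp

end Literature.Analysis.FluidPDE
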